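import Mathlib
import Literature.Analysis.FluidPDE.Tao2016AveragedNS.CascadeTableDictionary
import Literature.Analysis.FluidPDE.Tao2016AveragedNS.SelfSimilarCascadeBlowup
import Literature.Analysis.FluidPDE.Tao2016AveragedNS.SelfSimilarCascadeResidues
import Literature.Analysis.FluidPDE.Tao2016AveragedNS.ViscousDyadicMemberRegularity
import HarnessLib

/-!
# RAY REDUCTION: every INVARIANT RAY of a cancelling table carries the Katz–Pavlović chain — the general form of the
  twin-rotor embedding on the blow-up side of K2(1) `TaoLadderRungTwoBreak.BlowupRigidityOne`
  (stmt-NavierStokesRegularity-20206; `--supports`)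

MODEL lattice ODEs only (Tao 2016 §1.2, §4 (4.1)–(4.3), Lemma 4.1 (4.5)–(4.11), Thm. 4.2 statement shape); nothing here is
a statement about the Navier–Stokes equations; NO item is closed.  DEF-FREE; ROUTE-INDEPENDENT.

An INVARIANT RAY of a table `α` on `m` modes is a vector `u ∈ ℝ^m` on which the three structure maps act by scalars:
`Q(u) = q·u`, `A(u) = a·u`, `B(u,u) = b·u`.  Cancellation forces `q = 0` and `b = −a` (`invariantRay_coeffs`), and if
`a ≠ 0` the rescaled ray `a⁻¹u` is NORMALISED: `Q(u) = 0`, `A(u) = u`, `B(u,u) = −u` (`invariantRay_normalize`).  On the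
ray family `X_{i,n}(t) = s_n(t)·u_i` the cascade nonlinearity is then EXACTLY the dyadic one,
`quadTerm_{i,n} = (Λ_{n−1}s_{n−1}² − Λ_n s_n s_{n+1})·u_i` (`quadTerm_ray`), so:

* `tables_smul`, `invariantRay_coeffs`, `invariantRay_normalize`, `shellVec_ray`, `quadTerm_ray` — ray bookkeeping;
* `cascadeODESolutionFrom_ray_of_dyadic`, `hasGlobal_ray_of_dyadic` — every global `(K₁,K₂)`-pseudo-solution of the
  dyadic member from `c·1₀` at shell `n₀` becomes one of `α` from the ray datum `c·u` (amplitudes `× u_i`, energies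
  `× u_i²`), every `ε₀ > −1`;
* `noGlobalCascade_dyadic_of_ray`, `not_noGlobalCascade_ray_of_dyadic` — a robust blow-up of `α` from a ray datum is a
  robust blow-up of the dyadic member; every non-blow-up theorem for the dyadic member kills it
  (`not_noGlobalCascade_ray_one`: Barbato–Morandin–Romito at `ε₀ = 1`, `c ≥ 0`; `not_noGlobalCascade_ray_of_dyadicBreak`:
  the shape of item ⟨24644⟩ `OrthantWake.DyadicBreakBelowOne` on `(0,1)`).

The twin rotor of `…TwinRotorPseudo` is the normalised ray `u = ½(1,1,0,0)` of `twinRotorTable`; the dyadic member itself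
is the ray `u = 1₀` of `dyadicTable`.  READING for the census of ⟨20206⟩/⟨20204⟩: the Target on ANY table with a
normalised invariant ray contains remaining lemma (D) (direction «dyadic regular ⇒ ray regular» only).
HONEST LABEL: dictionary work; no stub, crux, rung or summit is proved; rung 0.
-/

noncomputable section

-- the summit and its single sub-problem share the name (CONVENTIONS §1)
set_option linter.dupNamespace false

open Set Filter Topology MeasureTheory intervalIntegral
open scoped RealInnerProductSpace

namespace Summit.NavierStokesRegularity.NavierStokesRegularity.Theorems

namespace BlowupRigidityOne

open Literature.Analysis.FluidPDE Literature.Analysis.FluidPDE.TaoCascade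

variable {m : ℕ} {α : Fin m → Fin m → Fin m → ℤ × ℤ × ℤ → ℝ}

/-! ## Invariant rays -/

/-- The structure maps along a ray: `Q(s u) = s² Q(u)`, `A(s u) = s² A(u)`, `B(s' u, s u) = s' s B(u, u)` (componentwise).
[cite: Tao2016AveragedNS, §4 (4.1), Lemma 4.1 (4.8); cell vocabulary (`tableQ`, `tableA`, `tableB`)] -/
theorem tables_smul (α : Fin m → Fin m → Fin m → ℤ × ℤ × ℤ → ℝ) (u : Em m) (s s' : ℝ) (i : Fin m) :
    tableQ α (s • u) i = s * s * tableQ α u i ∧ tableA α (s • u) i = s * s * tableA α u i ∧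
      tableB α (s' • u) (s • u) i = s' * s * tableB α u u i := by
  -- bilinearity of the coordinate forms (cf. `WakeRatchetCritical.qform_smul_smul`, not imported to stay route-independent)
  have hq : ∀ (μ : ℤ × ℤ × ℤ) (c d : ℝ) (y x : Em m), qform α μ (c • y) (d • x) i = c * d * qform α μ y x i := by
    intro μ c d y x
    unfold qform
    simp only [PiLp.smul_apply, smul_eq_mul, Finset.mul_sum]
    exact Finset.sum_congr rfl fun i₁ _ => Finset.sum_congr rfl fun i₂ _ => by ring
  refine ⟨?_, ?_, ?_⟩
  · rw [tableQ_apply, tableQ_apply, hq]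
  · rw [tableA_apply, tableA_apply, hq]
  · rw [tableB_apply, tableB_apply, hq, hq]; ring

/-- **Cancellation pins the ray coefficients**: if `Q(u) = q·u`, `A(u) = a·u`, `B(u,u) = b·u` for a cancelling table and
`u ≠ 0`, then `q = 0` (intra-shell neutrality `⟪u, Q u⟫ = 0`) and `b = −a` (`⟪u, A u⟫ + ⟪u, B(u,u)⟫ = 0`).
[cite: Tao2016AveragedNS, §4 (4.3); §5 (g-cancel); tree `table_sTable`] -/
theorem invariantRay_coeffs (hc : IsCancellingCoeff α) {u : Em m} (hu : u ≠ 0) {q a b : ℝ}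
    (hQ : tableQ α u = q • u) (hA : tableA α u = a • u) (hB : tableB α u u = b • u) : q = 0 ∧ b = -a := by
  have hST := table_sTable α hc
  have hn : ⟪u, u⟫ ≠ 0 := by rw [real_inner_self_eq_norm_sq]; positivity
  have h1 := hST.intra u
  rw [hQ, inner_smul_right] at h1
  have h2 := hST.cancel u u
  rw [hA, hB, inner_smul_right, inner_smul_right, ← add_mul] at h2
  exact ⟨(mul_eq_zero.1 h1).resolve_right hn, by linarith [(mul_eq_zero.1 h2).resolve_right hn]⟩

/-- **Normalising an invariant ray**: if `Q(u) = q·u`, `A(u) = a·u`, `B(u,u) = b·u` for a cancelling table with `u ≠ 0`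
and `a ≠ 0`, then `u' = a⁻¹u` satisfies `Q(u') = 0`, `A(u') = u'`, `B(u',u') = −u'`.
[cite: Tao2016AveragedNS, §4 (4.1), (4.3); cell vocabulary (normalised invariant ray)] -/
theorem invariantRay_normalize (hc : IsCancellingCoeff α) {u : Em m} (hu : u ≠ 0) {q a b : ℝ} (ha : a ≠ 0)
    (hQ : tableQ α u = q • u) (hA : tableA α u = a • u) (hB : tableB α u u = b • u) :
    tableQ α (a⁻¹ • u) = 0 ∧ tableA α (a⁻¹ • u) = a⁻¹ • u ∧ tableB α (a⁻¹ • u) (a⁻¹ • u) = -(a⁻¹ • u) := by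
  obtain ⟨hq, hb⟩ := invariantRay_coeffs hc hu hQ hA hB
  subst hq; subst hb
  refine ⟨?_, ?_, ?_⟩ <;> ext i <;>
    simp only [(tables_smul α u a⁻¹ a⁻¹ i).1, (tables_smul α u a⁻¹ a⁻¹ i).2.1, (tables_smul α u a⁻¹ a⁻¹ i).2.2,
      hQ, hA, hB, PiLp.smul_apply, PiLp.neg_apply, PiLp.zero_apply, smul_eq_mul, zero_mul, mul_zero]
  · field_simp
  · field_simp

/-! ## The ray family and its nonlinearity -/

/-- Shell vectors of the ray family `X_{i,k} = s_k u_i`: `x_k = s_k · u`.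
[cite: Tao2016AveragedNS, §4 Lemma 4.1 (amplitudes of one shell); cell vocabulary (`shellVec`)] -/
theorem shellVec_ray (s : Fin 4 → ℤ → ℝ → ℝ) (u : Em m) (k : ℤ) (t : ℝ) :
    shellVec (fun i k t => s 0 k t * u i) k t = s 0 k t • u := by
  ext i
  simp [shellVec_apply]

/-- **On a normalised invariant ray the cascade nonlinearity is the dyadic one**: if `Q(u) = 0`, `A(u) = u`,
`B(u,u) = −u`, then on `X_{i,n} = s_n u_i` (with `s = X^{dy}_{0,·}` any scalar chain)
`quadTerm^α_{i,n} = quadTerm^{dyadic}_{0,n}(s) · u_i`.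
[cite: Tao2016AveragedNS, §1.2 (dyadic model), §4 (4.1), Lemma 4.1 (4.8); tree `quadTerm_eq_tables`, `quadTerm_dyadicTable_zero`] -/
theorem quadTerm_ray {u : Em m} (hQ : tableQ α u = 0) (hA : tableA α u = u) (hB : tableB α u u = -u)
    (ε₀ : ℝ) (s : Fin 4 → ℤ → ℝ → ℝ) (i : Fin m) (n : ℤ) (t : ℝ) :
    quadTerm ε₀ α (fun i k t => s 0 k t * u i) i n t = quadTerm ε₀ dyadicTable s 0 n t * u i := by
  rw [quadTerm_eq_tables, shellVec_ray, shellVec_ray, shellVec_ray, (tables_smul α u (s 0 n t) (s 0 (n + 1) t) i).1,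
    (tables_smul α u (s 0 (n - 1) t) 0 i).2.1, (tables_smul α u (s 0 n t) (s 0 (n + 1) t) i).2.2, hQ, hA, hB,
    quadTerm_dyadicTable_zero]
  simp only [PiLp.zero_apply, PiLp.neg_apply, mul_zero]
  ring

/-! ## Dyadic pseudo-solutions embed along a normalised ray -/

/-- **THE RAY EMBEDDING OF PSEUDO-SOLUTIONS.**  For `ε₀ > −1` and a normalised invariant ray `u` of `α`
(`Q(u) = 0`, `A(u) = u`, `B(u,u) = −u`): if `(X, E)` obeys the conclusions (4.5)–(4.11) of Lemma 4.1 for the dyadic member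
with defect constants `(K₁, K₂)` from `X₀` at shell `n₀`, then the ray family `X_{0,n}·u_i` with energies `E_{0,n}·u_i²`
obeys them for `α` with the SAME `(K₁, K₂)` from the ray datum `(X₀ 0)·u`.
[cite: Tao2016AveragedNS, §1.2, §4 Lemma 4.1 (4.5)–(4.11); cell vocabulary (`CascadeODESolutionFrom`, invariant ray)] -/
theorem cascadeODESolutionFrom_ray_of_dyadic {ε₀ K₁ K₂ : ℝ} {n₀ : ℤ} {X₀ : Fin 4 → ℝ} {u : Em m}
    (hQ : tableQ α u = 0) (hA : tableA α u = u) (hB : tableB α u u = -u)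
    {X E : Fin 4 → ℤ → ℝ → ℝ} (hε : -1 < ε₀) (h : CascadeODESolutionFrom ε₀ dyadicTable K₁ K₂ n₀ X₀ X E) :
    CascadeODESolutionFrom ε₀ α K₁ K₂ n₀ (fun i => X₀ 0 * u i) (fun i k t => X 0 k t * u i)
      (fun i k t => E 0 k t * u i ^ 2) where
  contDiffOn_X i n := (h.contDiffOn_X 0 n).mul contDiffOn_const
  contDiffOn_E i n := (h.contDiffOn_E 0 n).mul contDiffOn_const
  nonneg_E i n t ht := mul_nonneg (h.nonneg_E 0 n t ht) (sq_nonneg _)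
  apriori_X T hT := by
    obtain ⟨M, hM⟩ := h.apriori_X T hT
    refine ⟨M * ∑ j, |u j|, fun t ht i n => ?_⟩
    have h1 : (0 : ℝ) < 1 + ε₀ := by linarith
    have hw : 0 ≤ 1 + (1 + ε₀) ^ ((10 : ℝ) * n) := by positivity
    have hMn := hM t ht 0 n
    have hM0 : 0 ≤ M := le_trans (mul_nonneg hw (abs_nonneg _)) hMn
    have hui : |u i| ≤ ∑ j, |u j| :=
      Finset.single_le_sum (f := fun j => |u j|) (fun j _ => abs_nonneg _) (Finset.mem_univ i)
    calc (1 + (1 + ε₀) ^ ((10 : ℝ) * n)) * |X 0 n t * u i|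
        = (1 + (1 + ε₀) ^ ((10 : ℝ) * n)) * |X 0 n t| * |u i| := by rw [abs_mul, mul_assoc]
      _ ≤ M * |u i| := mul_le_mul_of_nonneg_right hMn (abs_nonneg _)
      _ ≤ M * ∑ j, |u j| := mul_le_mul_of_nonneg_left hui hM0
  apriori_E T hT := by
    obtain ⟨M, hM⟩ := h.apriori_E T hT
    refine ⟨M * ∑ j, |u j|, fun t ht i n => ?_⟩
    have h1 : (0 : ℝ) < 1 + ε₀ := by linarith
    have hw : 0 ≤ 1 + (1 + ε₀) ^ ((10 : ℝ) * n) := by positivity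
    have hMn := hM t ht 0 n
    have hM0 : 0 ≤ M := le_trans (mul_nonneg hw (Real.sqrt_nonneg _)) hMn
    have hui : |u i| ≤ ∑ j, |u j| :=
      Finset.single_le_sum (f := fun j => |u j|) (fun j _ => abs_nonneg _) (Finset.mem_univ i)
    rw [Real.sqrt_mul (h.nonneg_E 0 n t ht.1), Real.sqrt_sq_eq_abs]
    calc (1 + (1 + ε₀) ^ ((10 : ℝ) * n)) * (Real.sqrt (E 0 n t) * |u i|)
        = (1 + (1 + ε₀) ^ ((10 : ℝ) * n)) * Real.sqrt (E 0 n t) * |u i| := by rw [mul_assoc]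
      _ ≤ M * |u i| := mul_le_mul_of_nonneg_right hMn (abs_nonneg _)
      _ ≤ M * ∑ j, |u j| := mul_le_mul_of_nonneg_left hui hM0
  init_E i n := by simp only [h.init_E]; ring
  init_X i n := by
    simp only [h.init_X]
    split_ifs <;> simp
  motion i n t ht := by
    rw [quadTerm_ray hQ hA hB]
    have hd : DifferentiableWithinAt ℝ (X 0 n) (Ici 0) t :=
      (h.contDiffOn_X 0 n).differentiableOn (by norm_num) t (mem_Ici.2 ht)
    rw [derivWithin_mul_const hd, ← sub_mul, abs_mul, Real.sqrt_mul (h.nonneg_E 0 n t ht), Real.sqrt_sq_eq_abs,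
      ← mul_assoc]
    exact mul_le_mul_of_nonneg_right (h.motion 0 n t ht) (abs_nonneg _)
  energy i n t ht := by
    rw [quadTerm_ray hQ hA hB]
    have hd : DifferentiableWithinAt ℝ (E 0 n) (Ici 0) t :=
      (h.contDiffOn_E 0 n).differentiableOn (by norm_num) t (mem_Ici.2 ht)
    rw [derivWithin_mul_const hd]
    have := mul_le_mul_of_nonneg_right (h.energy 0 n t ht) (sq_nonneg (u i))
    calc derivWithin (E 0 n) (Ici 0) t * u i ^ 2 ≤ quadTerm ε₀ dyadicTable X 0 n t * X 0 n t * u i ^ 2 := this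
      _ = quadTerm ε₀ dyadicTable X 0 n t * u i * (X 0 n t * u i) := by ring
  defect_lower i n t ht := by
    have := mul_le_mul_of_nonneg_right (h.defect_lower 0 n t ht) (sq_nonneg (u i))
    calc 1 / 2 * (X 0 n t * u i) ^ 2 = 1 / 2 * X 0 n t ^ 2 * u i ^ 2 := by ring
      _ ≤ E 0 n t * u i ^ 2 := this
  defect_upper i n t ht := by
    rw [intervalIntegral.integral_mul_const]
    have := mul_le_mul_of_nonneg_right (h.defect_upper 0 n t ht) (sq_nonneg (u i))
    calc E 0 n t * u i ^ 2
        ≤ (1 / 2 * X 0 n t ^ 2 + K₂ * (1 + ε₀) ^ ((2 : ℝ) * n) * ∫ s in (0 : ℝ)..t, E 0 n s) * u i ^ 2 := this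
      _ = 1 / 2 * (X 0 n t * u i) ^ 2 + K₂ * (1 + ε₀) ^ ((2 : ℝ) * n) * ((∫ s in (0 : ℝ)..t, E 0 n s) * u i ^ 2) := by
          ring
  noLow_X i n t hn ht := by simp only [h.noLow_X 0 n t hn ht, zero_mul]
  noLow_E i n t hn ht := by simp only [h.noLow_E 0 n t hn ht, zero_mul]

/-- **`HasGlobal` transfers from the dyadic member to every normalised invariant ray**, same `ε₀ > −1`, same budgets,
same starting shell: the ray datum is `(X₀ 0)·u`.
[cite: Tao2016AveragedNS, §4 Lemma 4.1 (4.5)–(4.11); cell vocabulary (`HasGlobal`, invariant ray)] -/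
theorem hasGlobal_ray_of_dyadic {ε₀ K₁ K₂ : ℝ} {n₀ : ℤ} {X₀ : Fin 4 → ℝ} {u : Em m}
    (hQ : tableQ α u = 0) (hA : tableA α u = u) (hB : tableB α u u = -u) (hε : -1 < ε₀)
    (h : HasGlobal ε₀ dyadicTable K₁ K₂ n₀ X₀) : HasGlobal ε₀ α K₁ K₂ n₀ (fun i => X₀ 0 * u i) := by
  obtain ⟨X, E, hXE⟩ := h
  exact ⟨_, _, cascadeODESolutionFrom_ray_of_dyadic hQ hA hB hε hXE⟩

/-- **A robust blow-up from a ray datum is a robust blow-up of the dyadic member.**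
`NoGlobalCascade ε₀ α (c·u) → NoGlobalCascade ε₀ dyadicTable (c·1₀)` for a normalised invariant ray `u` (`ε₀ > −1`).
[cite: Tao2016AveragedNS, §4 Thm. 4.2 (statement shape); cell vocabulary (`NoGlobalCascade`, invariant ray)] -/
theorem noGlobalCascade_dyadic_of_ray {ε₀ : ℝ} {u : Em m} (hQ : tableQ α u = 0) (hA : tableA α u = u)
    (hB : tableB α u u = -u) (hε : -1 < ε₀) (c : ℝ) (h : NoGlobalCascade ε₀ α (fun i => c * u i)) :
    NoGlobalCascade ε₀ dyadicTable (fun i => if i = (0 : Fin 4) then c else 0) := by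
  intro K₁ K₂ hK₁ hK₂
  obtain ⟨N₀, hN₀⟩ := h K₁ K₂ hK₁ hK₂
  refine ⟨N₀, fun n₀ hn₀ hglob => hN₀ n₀ hn₀ ?_⟩
  have h' := hasGlobal_ray_of_dyadic hQ hA hB hε hglob
  have e : (fun i => (fun j : Fin 4 => if j = (0 : Fin 4) then c else 0) 0 * u i) = fun i => c * u i := by
    funext i; simp
  rw [e] at h'
  exact h'

/-- **Every non-blow-up theorem for the dyadic member kills the ray's blow-up**:
`¬ NoGlobalCascade ε₀ dyadicTable (c·1₀) → ¬ NoGlobalCascade ε₀ α (c·u)`.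
[cite: Tao2016AveragedNS, §4 Thm. 4.2 (statement shape); cell vocabulary (`NoGlobalCascade`, invariant ray)] -/
theorem not_noGlobalCascade_ray_of_dyadic {ε₀ : ℝ} {u : Em m} (hQ : tableQ α u = 0) (hA : tableA α u = u)
    (hB : tableB α u u = -u) (hε : -1 < ε₀) (c : ℝ)
    (h : ¬ NoGlobalCascade ε₀ dyadicTable (fun i => if i = (0 : Fin 4) then c else 0)) :
    ¬ NoGlobalCascade ε₀ α (fun i => c * u i) :=
  fun hr => h (noGlobalCascade_dyadic_of_ray hQ hA hB hε c hr)

/-- **AT `ε₀ = 1` NO CANCELLING TABLE BLOWS UP ROBUSTLY FROM A NON-NEGATIVE MULTIPLE OF A NORMALISED INVARIANT RAY**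
(`c ≥ 0`): Barbato–Morandin–Romito's Theorem 1 (tree `not_noGlobalCascade_one_dyadicTable`) transported along the ray.
[cite: BarbatoMorandinRomito2011, Thm. 1] [cite: Tao2016AveragedNS, §1.2 p. 9, §4 Thm. 4.2; cell vocabulary] -/
theorem not_noGlobalCascade_ray_one {u : Em m} (hQ : tableQ α u = 0) (hA : tableA α u = u)
    (hB : tableB α u u = -u) {c : ℝ} (hc : 0 ≤ c) : ¬ NoGlobalCascade 1 α (fun i => c * u i) :=
  not_noGlobalCascade_ray_of_dyadic hQ hA hB (by norm_num) c
    (not_noGlobalCascade_one_dyadicTable (X₀ := fun i => if i = (0 : Fin 4) then c else 0) (by simp [hc])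
      (fun i hi => if_neg hi))

/-- **THE DYADIC BREAK BELOW ONE KILLS EVERY RAY BLOW-UP ON `(0,1)`**: the statement of item ⟨24644⟩
`OrthantWake.DyadicBreakBelowOne` (hypothesis `hD`; tree-certified on `[9/16, 1]`) gives, for every cancelling table with
a normalised invariant ray `u`, every `ε₀ ∈ (0,1)` and every `c`: `¬ NoGlobalCascade ε₀ α (c·u)`.
[cite: BarbatoMorandinRomito2011, Thm. 1] [cite: Tao2016AveragedNS, §4 Thm. 4.2; cell vocabulary (`OrthantWake.DyadicBreakBelowOne`)] -/
theorem not_noGlobalCascade_ray_of_dyadicBreak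
    (hD : ∀ ε₀ : ℝ, 0 < ε₀ → ε₀ < 1 → ∀ X₀ : Fin 4 → ℝ, ¬ NoGlobalCascade ε₀ dyadicTable X₀)
    {u : Em m} (hQ : tableQ α u = 0) (hA : tableA α u = u) (hB : tableB α u u = -u)
    {ε₀ : ℝ} (h0 : 0 < ε₀) (h1 : ε₀ < 1) (c : ℝ) : ¬ NoGlobalCascade ε₀ α (fun i => c * u i) :=
  not_noGlobalCascade_ray_of_dyadic hQ hA hB (by linarith) c (hD ε₀ h0 h1 _)

end BlowupRigidityOne

end Summit.NavierStokesRegularity.NavierStokesRegularity.Theorems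

end
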